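import Summits.QuantumFields.YangMills.Theorems.UnitScaleTiltProp7SectET3Prop4
import Literature.MathematicalPhysics.QuantumFieldTheory.Balaban1983to89.B11Eq117ChartLettersOnModel
import Literature.MathematicalPhysics.QuantumFieldTheory.Balaban1983to89.B11Eq118RegimeScalars
import Literature.MathematicalPhysics.QuantumFieldTheory.Balaban1983to89.B11Eq118RegimeRadiiUniform
import Literature.MathematicalPhysics.QuantumFieldTheory.Balaban1983to89.B11Eq44COperatorTowerGeometric
import Literature.MathematicalPhysics.QuantumFieldTheory.Balaban1983to89.B7Eq43AveragedSmallnessLevelFree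
import Literature.MathematicalPhysics.QuantumFieldTheory.Balaban1983to89.B7Eq43AveragedSmallnessLinearFeed
import Literature.MathematicalPhysics.QuantumFieldTheory.Balaban1983to89.B9Thm311LaplaceAkPositiveDiagonal
import Literature.MathematicalPhysics.QuantumFieldTheory.Balaban1983to89.B9Thm311LaplaceAkPiPositiveDiagonal
import Literature.MathematicalPhysics.QuantumFieldTheory.Balaban1983to89.B9Thm311SitePrimeFormCoerciveTowerCanonical
import Literature.MathematicalPhysics.QuantumFieldTheory.Balaban1983to89.B9Thm311SmallFieldClosed
import Literature.MathematicalPhysics.QuantumFieldTheory.Balaban1983to89.B9Eq326OperatorTowerRealityUnitary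
import Literature.MathematicalPhysics.QuantumFieldTheory.Balaban1983to89.B9Eq342GreenPrimeSupBound
import HarnessLib

/-!
# Route `UnitScaleTilt`, crux K1 child «MinimiserStabilityRegPr» (stmt-QuantumFields-19200), stub `stub_existenceMinimalOrbit` (EX), route (α) —
# (S2)-prop4, SECOND FILE: «prop4 ⇐ CLASS ∧ M_Δ ONLY» — on print's GLOBAL small-field class every N06 row of the `prop4` field of the T³ `SectEDatum`
# ([Balaban1985Variational] Prop. 4 (97)–(98) for `W = (δ/δA′)V` at the tower pair `(H̃_{1,k}, C_k)`) is PRODUCED in the tree; what remains displayed is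
# exactly the CLASS (the class-transfer face of N06(d = 3)), the (3.132) letter `M_Δ` and the (115) profile bounds

Cell `ym3-torus`, width seat `ym-ust-20520-w4` (gen 2; OWNER ym3-torus-plan g25 02:14:16Z: «YES to §4 «prop4 ⇐ CLASS ∧ M_Δ only» … that makes prop4's residual
EXACTLY the class-transfer face of N06(d = 3) + M_Δ — the clean DEPMAP edge»).  Companion of `UnitScaleTiltProp7SectET3Prop4` (§1 packaging, §2 the displayed
currency `exists_prop4Hyp_W80_latticeFree`, §3 `…_V0Jcur`); split off for the 400-line rule.  YM₃ on T³ is a ladder rung (R3), NOT the Clay problem; nothing here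
is a claim about the stub, the crux, d = 4 or the mass gap.  `--supports stmt-QuantumFields-19200 --as helper`; count-neutral.

THE PRINT.  [Balaban1985Variational] Prop. 4 p. 293: *«|((δ/δA′)V)(A′)|₍₋₃₎ ≦ C₄(max{|A′|₍₋₁₎, |∇A′|₍₋₂₎})², (98) … The constants a₃, C₄ depend on d and L
only.»*; [Balaban1985BackgroundPropagators] (3.35)–(3.36) p. 396 (the small-field class of the background: bond variables, plaquette variables and the current
`D*∂U` small at the scale `η`), Thm 3.11 p. 416 (positivity of `Δ_a(U)`), Thm 3.12 p. 423 (the operator `H₁` (3.129) bounded in the weighted sup norms).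

WHAT THIS FILE PROVES (ONE theorem; sorry-free; no definition; composition BY NAME — the pub-balaban NE9 leaf-01 g97 chain
`Summits/QuantumFields/BalabanUV/T4Continuum/Support/NE9CurChartTowerPiLatticeUniformClassW80{,VJ}` ∕ `…W80`, d-generic, with the chart conclusion replaced by
`Prop7SectET3Prop4.prop4Hyp_of_quadAnalytic_of_analyticOnNhd`; nothing of [Balaban1985BackgroundPropagators] Sect. 3 is proved HERE).
**`exists_prop4Hyp_W80_of_globalClass`** — for fixed `L ≥ 3`, the fibre ∕ trace letters of a finite-dimensional C⋆-algebra `𝔸`, [Balaban1985Averaging] Prop. 2's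
window `α₀` with Prop. 5's radius `ρ` and the surjectivity regime, the room `ρ_w`, the (115) weight-profile bounds `ω, Ω ≥ 1` and the W-slot letters `M_r, M_Δ`:
`∃ α₁ j₁ ε_C R′ C₄` BEFORE the lattice (`R′ > 0`, `C₄ ≥ 0`), then for EVERY height `n+1`, spacing `η` on the diagonal (`ηL^{n+1} = 1`, `c₀ = η^d`), periods `m`,
EVERY background `U` on `towerP L m (n+1)` with `Ũ ∈ unitaryUnits 𝔸`, `α ≤ α₁` and the three windows `‖U b − 1‖ ≤ αη`, `‖U(∂p) − 1‖ ≤ αη²`,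
`‖U(x,μ) − U(x−e_μ,μ)‖ ≤ αη²`, the current window `‖J_μ(y)‖ ≤ j₀ ≤ j₁`, level maps with `n+1 ≤ lev₀` and the profile bounds, EVERY fibre map `ρc` (`‖ρc‖ ≤ M_r`),
tracial ⋆-compatible contractive `τc`, and EVERY `Δ_π` with `‖Δ_π‖ ≤ M_Δ`: `∃ h52 hpos′ hposπ` (PRODUCED: (52) of [Balaban1985Averaging], the positivity of `Δ′_a` and
of `G = Δ_a + π†Δ_π` at the geometric per-level profile — they make `H̃_{1,k}` a defined object together with `QkW_surjective`) and
`Prop4Hyp (W80 ρc τc U H̃_{1,k} C_k ε_C (Jcur U) Δ_π) C₄ R′`.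
THE ROWS PRODUCED (★w2-20520 g2's census numbering): #8 ∕ #13 unitarity bookkeeping (`forall_star_eq_inv_of_mem`, `unitaryUnits_le_U1`, `norm_adTransportW_eq`),
#10 → (52) (`pdev_perCfg_le_of_plaq`), #12 tower regularity (`twoWindows_linear_feed`, `ulev_mem_U1_of_pdev`, `ulev_reg_of_pdev_geometric`, the geometric profile
`αT·L^{−2min(j+1,n+1)}`), #14 positivity (`exists_strong_site_coercive_tower_diagonal`, `exists_laplaceAkPi_pos_diagonal_closed`, `exists_laplaceAk_pos_diagonal_closed`),
#15 `QkW_surjective`, #19 the Thm 3.12 letter `b := ω·M_φBM_φ′·Ω` (`exists_norm_chartLetters_le`) and the Sect. C regime (`exists_regime_scalars`,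
`Regime.of_normBound_zeroLinear`, `quadAnalytic_Cck`), #20 `ϖ := ω³Ω`, #21 the kernel-route window by the choice of `(a_C, ε_C)`, #22 the V₀-slot
(`curV0_quadBound_lattice_uniform`, `R_V = 1/16`), #24 `‖Jcur U‖ ≤ ω³` (`B11Eq28JcurWindow`), #26 `R′ := min a_C ((1 − 4bC₂(ε_C + a_C))/16)`.
WHAT REMAINS DISPLAYED: the CLASS rows #9–#11, #16 (EX's (14)∕(3.35) backgrounds on T³ with holonomy are NOT in this class uniformly in the volume — RULING g25-№2
§1: THE located gap, «global small-field window → (3.35)-local with holonomy», shared with Track A's N06), #25 `M_Δ` ([Balaban1985BackgroundPropagators] (3.132); per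
lattice unless fed by the (117)-type rows of `B9Eq3119DeltaPiTower`), and the profile bounds (= 1 on EX's pure-small-field diagonal `lev ≡ K − n`).
Constants crude and symbolic; NOT print's `C₄(d, L)` valued.  Stated for every `d ≥ 1`; R3 reads `d = 3`.

References: T. Bałaban, CMP 102 (1985) 277–309 [Balaban1985Variational] (Prop. 4 (97)–(98) pp.292–293, (27)–(28) p.282, (103) p.293, Prop. 6 (117)–(121) p.295);
CMP 99 (1985) 389–434 [Balaban1985BackgroundPropagators] ((3.35)–(3.37) p.396, Thm 3.11 p.416, (3.122) p.420, Thm 3.12 p.423, (3.132) p.423);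
CMP 98 (1985) 17–51 [Balaban1985Averaging] (Prop. 2 (52)–(54) p.26, Prop. 5 (157) p.42).
-/

noncomputable section

open Metric Set
open scoped InnerProductSpace ComplexConjugate BigOperators

namespace Summit.QuantumFields.YangMills.Theorems.Prop7SectET3Prop4

open Literature.MathematicalPhysics.QuantumFieldTheory.Balaban1983to89
open B11Eq103H1Complex (SiteL2K BondL2K H1LatticeCLM)
open B11Eq115Space
open B11Eq174Chart (Regime)
open B11Prop6Scheme (Prop4Hyp)
open B13Contraction113 (QuadAnalytic)
open B4Sect5Torus (TSite)
open B4Sect5Proof (latticeConst)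
open B9SectCLatticeCarrier (Bond unshift)
open B7Prop1Explicit (U1 Wcx boxVec)
open B7Prop2Explicit (pdev AvgClosed C0 c2')
open B7Prop3Flat (c3)
open B7Prop5GeneralLevels (thetaGen C3Gen)
open B9Eq310DeltaPrime (plaqHolU)
open B9Eq310HessianOperator (adTransportW)
open B9Eq315QTorus (perCfg cornerSite)
open B9Eq315QTower (towerP UlevOf)
open B9Eq326OperatorTower (QkW laplaceAk)
open B9Eq324DeltaPrimeATower (laplacePrimeAk)
open B9Eq3119DeltaPiTower (laplaceAkPi)
open B11Eq44COperatorTower (C2T)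
open B11Eq44CLetterTower (Cck)
open B11Eq80Current (W80)
open B11Eq63V0GroupCurrent (curV0)
open B11Eq98CurrentSlot (C4W Jcur)
open B11Eq111FrakG (nabla115)
open B11Eq98V0LettersLatticeUniform (curV0_quadBound_lattice_uniform)
open B11Eq28JcurWindow (norm_Jcur_le_of_window levWeight_three_le)

/-! ## §4 «prop4 ⇐ CLASS ∧ M_Δ only»: on print's GLOBAL small-field class every N06 row of `prop4` is PRODUCED in the tree (the class-transfer face, explicit) -/

section GlobalClass

open B11Eq103H1Complex B11Eq174Chart
open B7Prop2Explicit (unitaryUnits avgClosed_unitaryUnits unitaryUnits_le_U1)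
open B9Eq326OperatorTower (QkW_surjective)
open B11Eq44COperatorTower (αT αT_le ulev_mem_U1_of_pdev C2T_nonneg)
open B11Eq44COperatorTowerGeometric (ulev_reg_of_pdev_geometric geomProfile_nonneg geomProfile_le_αT sum_geomProfile_le)
open B11Eq44CLetterTower (quadAnalytic_Cck)
open B9Thm311SmallFieldClosed (hRS_of_unitary)
open B9Eq315QTorusOnto (liftSite perSite_liftSite)
open B7Eq43AveragedSmallnessLevelFree (pdev_perCfg_le_of_plaq)
open B7Eq43AveragedSmallnessLinearFeed (twoWindows_linear_feed)
open B9Thm311SitePrimeFormCoerciveTowerCanonical (exists_strong_site_coercive_tower_diagonal)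
open B9Thm311LaplaceAkPiPositiveDiagonal (exists_laplaceAkPi_pos_diagonal_closed)
open B9Thm311LaplaceAkPositiveDiagonal (exists_laplaceAk_pos_diagonal_closed)
open B9Eq326OperatorTowerRealityUnitary (UlevOf_star_eq_inv forall_star_eq_inv_of_mem)
open B9Eq342GreenPrimeSupBound (norm_adTransportW_eq)
open B11Eq118RegimeScalars (exists_regime_scalars)
open B11Eq118RegimeRadiiUniform (Regime.of_normBound_zeroLinear)
open B11Eq117ChartLettersOnModel (exists_norm_chartLetters_le)
open B11Eq98CurrentSlot (C4W_nonneg)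

variable {d : ℕ} (hd : 1 ≤ d) (L : ℕ) [NeZero L] (hL : 1 ≤ L) (hL2 : 2 ≤ L) (hL3 : 3 ≤ L) [Fact (0 < (L : ℝ))]
  {𝔸 : Type*} [CStarAlgebra 𝔸] [Nontrivial 𝔸] [FiniteDimensional ℂ 𝔸]
  {W : Type*} [NormedAddCommGroup W] [InnerProductSpace ℂ W] [FiniteDimensional ℂ W] (φ : W ≃ₗ[ℂ] 𝔸)
  {Mφ Mφ' : ℝ} (hMφ : 0 ≤ Mφ) (hMφ' : 0 ≤ Mφ') (hφ : ∀ w, ‖φ w‖ ≤ Mφ * ‖w‖) (hφ' : ∀ X, ‖φ.symm X‖ ≤ Mφ' * ‖X‖)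
  {a : ℝ} (ha : 0 < a) {a' : ℝ} (ha' : 0 < a')
  (τ : 𝔸 →ₗ[ℂ] ℂ) {Cτ : ℝ} (hτ : ∀ X, ‖τ X‖ ≤ Cτ * ‖X‖) (hCτ : 0 ≤ Cτ) {Mτ : ℝ} (hτm : ∀ X Y : 𝔸, ‖τ (X * Y)‖ ≤ Mτ * ‖X‖ * ‖Y‖) (hMτ : 0 ≤ Mτ)
  {ρw : ℝ} (hρw : 0 ≤ ρw)
  (hτ₁ : ∀ X : 𝔸, τ (star X) = conj (τ X)) (hτ₂ : ∀ X Y : 𝔸, τ (X * Y) = τ (Y * X)) (hφτ : ∀ X Y : 𝔸, ⟪φ.symm X, φ.symm Y⟫_ℂ = τ (star X * Y))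
  {α₀ : ℝ} (hα₀ : 0 < α₀) (hα3 : C0 d * α₀ ≤ 1 / 3) (hα4 : 4 * α₀ ≤ c2' d L)
  (hαL : 50 * (d + 1) * αT d L α₀ * (L : ℝ) ^ d ≤ 1 / 2)
  {ρ : ℝ} (hρ0 : 0 < ρ) (hρ : Real.exp (4 * (800 * ((d : ℝ) + 1) ^ 2 * ((d : ℝ) + 4)) * α₀) * (1 + 8 * (131072 * ((d : ℝ) + 1) ^ 2) * ρ) ≤ 2)
  (hρ4 : 4 * ρ ≤ c3 d L) (hθ : 2 * d * thetaGen d L α₀ ≤ (L : ℝ) ^ 3 / 16) (hC3 : 2 * d * C3Gen d L * ρ ≤ 1)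
  {ω Ω : ℝ} (hω1 : 1 ≤ ω) (hΩ1 : 1 ≤ Ω) {Mr MΔ : ℝ} (hMr : 0 ≤ Mr) (hMΔ : 0 ≤ MΔ)

-- deep definitional unfolding `laplaceAkPi` ↦ `laplaceALatticeK … (π†Δπ) …` in the statement (as the pub-balaban hosts)
set_option maxRecDepth 8192 in
set_option maxHeartbeats 1600000 in -- the block PRODUCED letter by letter, the regime PRODUCED, §2 applied once
include hd hL2 hL3 hMφ hMφ' hφ hφ' ha ha' hτ hCτ hτm hMτ hρw hτ₁ hτ₂ hφτ hα₀ hα3 hα4 hαL hρ0 hρ hρ4 hθ hC3 hω1 hΩ1 hMr hMΔ in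
/-- **«prop4 ⇐ CLASS ∧ M_Δ ONLY» — THE CLASS-TRANSFER FACE OF N06(d = 3) MADE EXPLICIT.**  On print's GLOBAL small-field class ([Balaban1985BackgroundPropagators]
(3.35)–(3.36): a unitary-group-valued background `U` of a C⋆-algebra on the tower lattice with `‖U(b) − 1‖ ≤ αη`, `‖U(∂p) − 1‖ ≤ αη²`, the bond-gradient window
`αη²` and the current window `‖J_μ(y)‖ ≤ j₀ ≤ j₁`) EVERY N06 row of the `prop4` field is PRODUCED in the tree, d-generically and lattice-uniformly: the positivity
of `Δ′_a, Δ_a, G` (Thm 3.11: `B9Thm311SitePrimeFormCoerciveTowerCanonical`, `B9Thm311LaplaceAk(Pi)PositiveDiagonal`), the tower-regularity block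
(`B7Eq43AveragedSmallnessLinearFeed.twoWindows_linear_feed`, [Balaban1985Averaging] Prop. 2 at the geometric profile), the Thm 3.12 letter `b` of `H̃_{1,k}`
(`B11Eq117ChartLettersOnModel.exists_norm_chartLetters_le`) hence the Sect. C regime of `(H̃_{1,k}, C_k)` (`B11Eq118RegimeScalars`, `Regime.of_normBound_zeroLinear`,
`B11Eq44CLetterTower.quadAnalytic_Cck`), the V₀-group's slot (§3) and the current letter (§3).  STATEMENT: `∃ α₁ j₁ ε_C R′ C₄` BEFORE the lattice (`C₄ ≥ 0`, `R′ > 0`),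
then for EVERY height `n+1`, spacing `η` on the diagonal (`ηL^{n+1} = 1`, `c₀ = η^d`), periods `m`, EVERY background `U` of the class with `α ≤ α₁`, level maps with
`n+1 ≤ lev₀` and the (115) profile bounds `(ω, Ω)`, EVERY fibre map `ρc` (`‖ρc‖ ≤ M_r`), tracial ⋆-compatible contractive `τc`, and EVERY `Δ_π` with `‖Δ_π‖ ≤ M_Δ`:
`∃ h52 hpos′ hposπ` (PRODUCED — they make `H̃_{1,k}` a defined object at the geometric profile and `QkW_surjective`) and
`Prop4Hyp (W80 ρc τc U H̃_{1,k} C_k ε_C (Jcur U) Δ_π) C₄ R′`.  WHAT REMAINS DISPLAYED is exactly: the CLASS (EX's (14)∕(3.35) backgrounds on T³ with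
holonomy are NOT in it uniformly in the volume — RULING g25-№2 §1, the located gap), the letter `M_Δ` ((3.132), fed per lattice unless by the (117)-type rows of
`B9Eq3119DeltaPiTower`), and the profile bounds.  Proof = the pub-balaban NE9 leaf-01 g97 composition (`Support/NE9CurChartTowerPiLatticeUniformClassW80{,VJ}` +
`…W80`) with the chart conclusion replaced by §1; nothing of [Balaban1985BackgroundPropagators] Sect. 3 is proved HERE. [folklore]
[cite: Balaban1985Variational, Prop. 4 (97)–(98) pp.292–293, (27)–(28) p.282, (103) p.293, Prop. 6 (117)–(121) p.295; Balaban1985BackgroundPropagators, (3.35)–(3.37) p.396, Thm 3.11 p.416, (3.122) p.420, Thm 3.12 p.423; Balaban1985Averaging, Prop. 2 (52)–(54) p.26, Prop. 5 (157) p.42] -/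
theorem exists_prop4Hyp_W80_of_globalClass :
    ∃ α₁ j₁ εC R' C₄ : ℝ, 0 < α₁ ∧ 0 < j₁ ∧ 0 < R' ∧ 0 ≤ C₄ ∧
      ∀ (n : ℕ) (η : ℝ) [Fact (0 < η)] (hηL : η * (L : ℝ) ^ (n + 1) = 1) (c₀ c₁ : ℝ) [Fact (0 < c₀)] [Fact (0 < c₁)]
        (_hw : c₀ * ((L : ℝ) ^ (n + 1)) ^ d = c₁) (_hc₀η : c₀ = η ^ d) (_hρ : |η| ^ d / c₀ ≤ ρw) (m : Fin d → ℕ) [∀ i, NeZero (m i)] (_hm : ∀ i, 1 ≤ m i)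
        (U : Bond d (towerP L m (n + 1)) → 𝔸ˣ) (hUG : ∀ (x : B7Prop1Explicit.Site d) (κ : Fin d), perCfg (towerP L m (n + 1)) U x κ ∈ unitaryUnits 𝔸)
        (α : ℝ) (_hα : 0 ≤ α) (_hαle : α ≤ α₁) (_hUη : ∀ b, ‖(U b : 𝔸) - 1‖ ≤ α * η)
        (_hpl : ∀ p : B9SectCLatticeCarrier.Plaq d (towerP L m (n + 1)), ‖(plaqHolU U p : 𝔸) - 1‖ ≤ α * η ^ 2)
        (_hUgrad : ∀ (x : TSite d (towerP L m (n + 1))) (μ : Fin d), ‖(U (x, μ) : 𝔸) - U (unshift μ x, μ)‖ ≤ α * η ^ 2)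
        (j₀ : ℝ) (_hJ : ∀ μ y, ‖B9Eq39Adjoint.J (fun μ => B9Eq33CovDerivVector.shiftEquiv μ) (fun μ y => U (y, μ)) η μ y‖ ≤ j₀) (_hj : j₀ ≤ j₁)
        (lev₀ : Bond d (towerP L m (n + 1)) → ℕ) (lev₁ : Bond d (towerP L m (n + 1)) × Fin d → ℕ) (levB : Bond d m → ℕ) (_hlev : ∀ b, n + 1 ≤ lev₀ b)
        (_hw₀ : (NegSup.wSup (levWeight (L : ℝ) η lev₀ 1) : ℝ) ≤ ω) (_hw₁ : (NegSup.wSup (levWeight (L : ℝ) η lev₁ 2) : ℝ) ≤ ω)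
        (_hw₃ : (NegSup.wInvSup (levWeight (L : ℝ) η lev₀ 3) : ℝ) ≤ Ω) (_hwB : (NegSup.wInvSup (levWeight (L : ℝ) η levB 0) : ℝ) ≤ Ω)
        (_hw₁' : (NegSup.wInvSup (levWeight (L : ℝ) η lev₁ 2) : ℝ) ≤ Ω)
        (ρc : (𝔸 →L[ℂ] ℂ) →L[ℂ] 𝔸) (τc : 𝔸 →L[ℂ] ℂ) (_hρc : ‖ρc‖ ≤ Mr)
        (_hτc2 : ∀ X Y : 𝔸, τc (X * Y) = τc (Y * X)) (_hτcs : ∀ X : 𝔸, τc (star X) = starRingEnd ℂ (τc X)) (_hτc1 : ∀ X : 𝔸, ‖τc X‖ ≤ ‖X‖)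
        (Δπ : Space115 (L : ℝ) η lev₀ lev₁ (nabla115 η U) →L[ℂ] NegSize (L : ℝ) η lev₀ 3 𝔸) (_hΔn : ‖Δπ‖ ≤ MΔ),
      ∃ h52 : pdev (perCfg (towerP L m (n + 1)) U) < α₀ * (((L : ℝ) ^ (n + 1))⁻¹) ^ 2,
      ∃ hpos' : ∀ x : SiteL2K ℂ d (towerP L m (n + 1)) c₀ W, x ≠ 0 →
          0 < RCLike.re ⟪x, laplacePrimeAk L m n φ η U a' (c₁ := c₁) x⟫_ℂ,
      ∃ hposπ : ∀ x : BondL2K ℂ d (towerP L m (n + 1)) c₀ W, x ≠ 0 →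
          0 < RCLike.re ⟪x, laplaceAkPi L m n φ τ η U a' hpos' hL (fun j => αT d L α₀ * (((L : ℝ) ^ min (j + 1) (n + 1))⁻¹) ^ 2)
            (fun j => (geomProfile_le_αT (d := d) L (n + 1) hL hα₀.le j).trans (αT_le hL hα4))
            (ulev_mem_U1_of_pdev L m (n + 1) U hL2 (avgClosed_unitaryUnits d L) hUG hα₀ hα3 hα4 h52)
            (ulev_reg_of_pdev_geometric L m (n + 1) U hL2 (avgClosed_unitaryUnits d L) hUG hα₀ hα3 hα4 h52) (c₁ := c₁) a x⟫_ℂ,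
        Prop4Hyp (W80 ρc τc U (H1LatticeCLM (L := (L : ℝ)) (η := η) (lev₀ := lev₀) (levB := levB) φ hposπ
              (QkW_surjective L m n φ U hL _ _ _ _ fun j => le_trans (mul_le_mul_of_nonneg_right (mul_le_mul_of_nonneg_left
                (geomProfile_le_αT (d := d) L (n + 1) hL hα₀.le j) (by positivity)) (by positivity)) hαL) lev₁ (nabla115 η U))
            (Cck L m η (n + 1) U lev₀ lev₁ (nabla115 η U) levB) εC (Jcur (L := (L : ℝ)) (η := η) (lev₀ := lev₀) U) Δπ) C₄ R' := by
  classical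
  have hL0 : (0 : ℝ) < L := by exact_mod_cast lt_of_lt_of_le (by norm_num) hL2
  have hL1 : (1 : ℝ) ≤ (L : ℝ) := by exact_mod_cast hL
  have hr0 : (0 : ℝ) ≤ 1 / (L : ℝ) := by positivity
  have hr1 : 1 / (L : ℝ) < 1 := by rw [div_lt_one hL0]; exact_mod_cast lt_of_lt_of_le (by norm_num) hL2
  have hstar : ∀ X : 𝔸, ‖star X‖ ≤ ‖X‖ := fun X => (norm_star X).le
  have hT0 : 0 ≤ αT d L α₀ := by unfold αT; positivity
  have hω : 0 ≤ ω := zero_le_one.trans hω1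
  have hΩ : 0 ≤ Ω := zero_le_one.trans hΩ1
  have hω0 : 0 < ω := lt_of_lt_of_le one_pos hω1
  have hΩ0 : 0 < Ω := lt_of_lt_of_le one_pos hΩ1
  -- the V₀-group's lattice-free letter `C_V` at `‖ρc‖ ≤ M_r`, `‖τc‖ ≤ 1`, `α ≤ 1`; `R_V = 1/16`; `M_t := 1`, `M_J := ω³`
  obtain ⟨CV, hCVdef⟩ : ∃ CV : ℝ, CV = 1024 * ((d - 1 : ℕ) : ℝ) * (ω * Ω) ^ 3 * Mr * (1 * 1 * ω ^ 2 + 1 / 16)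
      + ((d - 1 : ℕ) : ℝ) * (ω * Ω) ^ 3 * (136 + 2 * (ω * Ω)) * Mr * 1 := ⟨_, rfl⟩
  have hCV : 0 ≤ CV := by rw [hCVdef]; positivity
  -- §2 on the MODEL block at `ϱ := 1∕L`, `AQ := αT∕3` (its `∃ (α₁′, j₁′, B′, δ′)` first)
  obtain ⟨α₁', j₁', B', δ', hα₁', hj₁', hB', hδ', HW⟩ :=
    exists_prop4Hyp_W80_latticeFree hd L hL hL3 φ hMφ hMφ' hφ hφ' hstar ha ha' hr0 hr1 τ hτ hCτ hτm hMτ hρw hτ₁ hτ₂ hφτ (αT d L α₀ / 3)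
  -- the two chart letters on the MODEL block (the Thm 3.12 letter of `H̃_{1,k}`), `∃`-first
  obtain ⟨α₁, j₁, B, hα₁, hj₁, hB, HL⟩ :=
    exists_norm_chartLetters_le hd L hL hL3 φ hMφ hMφ' hφ hφ' hstar ha ha' hr0 hr1 τ hτ hCτ hτm hMτ hρw hτ₁ hτ₂ hφτ (αT d L α₀ / 3)
  -- ONE majorant of the `H̃_{1,k}` norm, before `∀`
  obtain ⟨CG, hCGdef⟩ : ∃ CG : ℝ, CG = ω * (Mφ * B * Mφ') * Ω := ⟨_, rfl⟩
  have hCG : 0 ≤ CG := by rw [hCGdef]; positivity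
  -- the lattice-free letters of the kernel route and the weight ratio
  obtain ⟨Θ, hΘdef⟩ : ∃ Θ : ℝ, Θ = Mφ * B' * Mφ' * (d * latticeConst d δ') := ⟨_, rfl⟩
  obtain ⟨Γ, hΓdef⟩ : ∃ Γ : ℝ, Γ = C3Gen d L * (2 ^ d * (2 * d)) := ⟨_, rfl⟩
  obtain ⟨ϖ, hϖdef⟩ : ∃ ϖ : ℝ, ϖ = ω ^ 3 * Ω := ⟨_, rfl⟩
  have hK0 : 0 ≤ latticeConst d δ' := B4Sect5Proof.latticeConst_nonneg d hδ'.le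
  have hC30 : 0 ≤ C3Gen d L := by unfold C3Gen B7Prop5GeneralLevels.C1ppGen; positivity
  have hΘ0 : 0 ≤ Θ := by rw [hΘdef]; positivity
  have hΓ0 : 0 ≤ Γ := by rw [hΓdef]; positivity
  have hϖ0 : 0 ≤ ϖ := by rw [hϖdef]; positivity
  -- the Sect. C radii `(a_C, ε_C)` from `(CG, C₂, ρ)` below the cap `min ρ (1/(2(ΘΓ+1)))`
  have hcap0 : 0 < min ρ (1 / (2 * (Θ * Γ + 1))) := lt_min hρ0 (by positivity)
  obtain ⟨jT, aC, εC, hjT, haC, hεC, hcapT, hCdom, hCself, hCcontr⟩ :=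
    exists_regime_scalars (B₀ := CG) (C₄ := C2T d α₀) (a₃ := ρ) hCG (C2T_nonneg d α₀) hρ0 hcap0
  have hεaρ : εC + aC ≤ ρ := hcapT.trans (min_le_left _ _)
  have hq : (εC + aC) * Θ * Γ ≤ 1 / 2 := by
    have h1 : εC + aC ≤ 1 / (2 * (Θ * Γ + 1)) := hcapT.trans (min_le_right _ _)
    have h2 : (εC + aC) * (Θ * Γ) ≤ 1 / (2 * (Θ * Γ + 1)) * (Θ * Γ) := mul_le_mul_of_nonneg_right h1 (by positivity)
    have h3 : 1 / (2 * (Θ * Γ + 1)) * (Θ * Γ) ≤ 1 / 2 := by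
      rw [div_mul_eq_mul_div, div_le_div_iff₀ (by positivity) (by norm_num)]; nlinarith
    nlinarith
  have h1q : 0 < 1 - 4 * CG * C2T d α₀ * (εC + aC) := by linarith
  -- the W-slot's `(C₄, R′)` at these radii (lattice-free)
  obtain ⟨RW, hRWdef⟩ : ∃ RW : ℝ, RW = min aC ((1 - 4 * CG * C2T d α₀ * (εC + aC)) * (1 / 16)) := ⟨_, rfl⟩
  have hRW0 : 0 < RW := by rw [hRWdef]; exact lt_min haC (by positivity)
  have hRWa : RW ≤ aC := by rw [hRWdef]; exact min_le_left _ _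
  have hRWV : RW ≤ (1 - 4 * CG * C2T d α₀ * (εC + aC)) * (1 / 16) := by rw [hRWdef]; exact min_le_right _ _
  have hC₄ : 0 ≤ C4W Mr 1 (ω ^ 3) MΔ CG (C2T d α₀) (1 / (1 - 4 * CG * C2T d α₀ * (εC + aC)))
      ((2 * (1 / (1 - 4 * CG * C2T d α₀ * (εC + aC))) + 1) * (ϖ * (Mφ * B' * Mφ' * (d * latticeConst d δ'))) * (C3Gen d L * (2 ^ d * (2 * d))) / aC)
      (2 * (ϖ * (Mφ * B' * Mφ' * (d * latticeConst d δ'))) * (C3Gen d L * (2 ^ d * (2 * d))) * (1 / (1 - 4 * CG * C2T d α₀ * (εC + aC)))) CV RW :=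
    C4W_nonneg hMr zero_le_one (by positivity) hMΔ hCG (C2T_nonneg d α₀) (by positivity) (by positivity) hCV hRW0.le
  -- the three positivity suppliers, `∃`-first
  obtain ⟨αS, γ', hαS, hγ', HS⟩ := exists_strong_site_coercive_tower_diagonal (d := d) L φ hMφ hMφ' hφ hφ' ha' hr0 hr1
  obtain ⟨αQ, hαQ, HQ⟩ := exists_laplaceAkPi_pos_diagonal_closed (d := d) L hL φ hMφ hMφ' hφ hφ' ha ha' hr0 hr1 τ hτ hCτ hρw
  obtain ⟨αA, hαA, HA⟩ := exists_laplaceAk_pos_diagonal_closed (d := d) L hL φ hMφ hMφ' hφ hφ' ha hr0 hr1 τ hτ hCτ hρw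
  -- the α-linear two-window feed below the least threshold
  obtain ⟨T, hT, F⟩ := twoWindows_linear_feed L hL2 (d := d) (𝔸 := 𝔸) (lt_min (lt_min hα₁ hα₁') (lt_min hαS (lt_min hαQ hαA)))
  refine ⟨min (min T (α₀ / 2)) 1, min (min j₁ j₁') 1, εC, RW, _, lt_min (lt_min hT (by positivity)) one_pos,
    lt_min (lt_min hj₁ hj₁') one_pos, hRW0, hC₄, ?_⟩
  intro n η _ hηL c₀ c₁ _ _ hw hc₀η hρ' m _ hm U hUG α hα0 hαle hUη hpl hUgrad j₀ hJ hj' lev₀ lev₁ levB hlev hw₀ hw₁ hw₃ hwB hw₁' ρc τc hρc' hτc2 hτcs hτc1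
    Δπ hΔn
  have hη0 : 0 < η := Fact.out
  have hαT' : α ≤ T := hαle.trans ((min_le_left _ _).trans (min_le_left _ _))
  have hαh : α ≤ α₀ / 2 := hαle.trans ((min_le_left _ _).trans (min_le_right _ _))
  have hαle1 : α ≤ 1 := hαle.trans (min_le_right _ _)
  have hj'' : j₀ ≤ j₁ := hj'.trans ((min_le_left _ _).trans (min_le_left _ _))
  have hjW : j₀ ≤ j₁' := hj'.trans ((min_le_left _ _).trans (min_le_right _ _))
  have hj1 : j₀ ≤ 1 := hj'.trans (min_le_right _ _)
  -- the class: `U(b)` unitary, `U(b)⋆ = U(b)⁻¹`, `U(b) ∈ U1`, mutually adjoint transporters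
  have hUS : ∀ b, U b ∈ unitaryUnits 𝔸 := fun b => by
    have h := hUG (liftSite b.1) b.2
    rwa [B9Eq315QTorus.perCfg_apply, perSite_liftSite] at h
  have hUst : ∀ b, star (U b : 𝔸) = (((U b)⁻¹ : 𝔸ˣ) : 𝔸) := forall_star_eq_inv_of_mem hUS
  have hUb : ∀ b, U b ∈ U1 𝔸 := fun b => unitaryUnits_le_U1 (hUS b)
  have hRS := hRS_of_unitary φ τ hφτ hτ₂ U hUst
  -- (52) from the PLAQUETTE window
  have hη : ((L : ℝ) ^ (n + 1))⁻¹ = η := inv_eq_of_mul_eq_one_left hηL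
  have h52 : pdev (perCfg (towerP L m (n + 1)) U) < α₀ * (((L : ℝ) ^ (n + 1))⁻¹) ^ 2 := by
    have hp := pdev_perCfg_le_of_plaq (U := U) hUb (by positivity) hpl
    rw [hη]
    exact lt_of_le_of_lt hp (mul_lt_mul_of_pos_right (by linarith) (by positivity))
  -- every level background unitary ⟹ its fibre transporters preserve the norm
  have hLu : ∀ (j : ℕ) (b : Bond d (towerP L m (j + 1))), star (UlevOf L m (n + 1) U j b : 𝔸) = ((UlevOf L m (n + 1) U j b)⁻¹ : 𝔸ˣ) :=
    UlevOf_star_eq_inv L m n hL2 hUS hα₀ hα3 (by linarith) h52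
  have hRlev : ∀ (j : ℕ) (b : Bond d (towerP L m (j + 1))) (w : W), ‖adTransportW φ (UlevOf L m (n + 1) U j) b w‖ ≤ ‖w‖ := fun j b w =>
    (norm_adTransportW_eq φ (UlevOf L m (n + 1) U j) τ hτ₂ (hLu j) hφτ b w).le
  -- the feed: bond-deviation profile `εU ≤ Kα·L^{−j}`, the windows at `β = Kα`
  obtain ⟨hβ0, hβ1, -, hUη', hpl', hUlev, εU, hεU, hUε, hεg⟩ := F m n (avgClosed_unitaryUnits d L) hUS hηL hα0 hαT' hUη hpl
  have hβL : (1 + 512 * (d + 1) * (d + 4)) * α ≤ α₁ := hβ1.trans ((min_le_left _ _).trans (min_le_left _ _))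
  have hβW : (1 + 512 * (d + 1) * (d + 4)) * α ≤ α₁' := hβ1.trans ((min_le_left _ _).trans (min_le_right _ _))
  have hβS : (1 + 512 * (d + 1) * (d + 4)) * α ≤ αS := hβ1.trans ((min_le_right _ _).trans (min_le_left _ _))
  have hβQ : (1 + 512 * (d + 1) * (d + 4)) * α ≤ αQ := hβ1.trans ((min_le_right _ _).trans ((min_le_right _ _).trans (min_le_left _ _)))
  have hβA : (1 + 512 * (d + 1) * (d + 4)) * α ≤ αA := hβ1.trans ((min_le_right _ _).trans ((min_le_right _ _).trans (min_le_right _ _)))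
  have hαβ : α ≤ (1 + 512 * (d + 1) * (d + 4)) * α := by
    have h1 : (1 : ℝ) ≤ 1 + 512 * (d + 1) * (d + 4) := by
      have : (0 : ℝ) ≤ 512 * (d + 1) * (d + 4) := by positivity
      linarith
    exact le_mul_of_one_le_left hα0 h1
  have hUgrad' : ∀ (x : TSite d (towerP L m (n + 1))) (μ : Fin d), ‖(U (x, μ) : 𝔸) - U (unshift μ x, μ)‖ ≤ (1 + 512 * (d + 1) * (d + 4)) * α * η ^ 2 :=
    fun x μ => (hUgrad x μ).trans (mul_le_mul_of_nonneg_right hαβ (by positivity))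
  -- the per-level data at the geometric profile
  have hα0' : ∀ j, 0 ≤ αT d L α₀ * (((L : ℝ) ^ min (j + 1) (n + 1))⁻¹) ^ 2 := geomProfile_nonneg (d := d) L (n + 1) hα₀.le
  have hαL' : ∀ j, 50 * (d + 1) * (αT d L α₀ * (((L : ℝ) ^ min (j + 1) (n + 1))⁻¹) ^ 2) * (L : ℝ) ^ d ≤ 1 / 2 := fun j =>
    le_trans (mul_le_mul_of_nonneg_right (mul_le_mul_of_nonneg_left (geomProfile_le_αT (d := d) L (n + 1) hL hα₀.le j) (by positivity))
      (by positivity)) hαL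
  have hAQ : ∑ j ∈ Finset.range (n + 1), αT d L α₀ * (((L : ℝ) ^ min (j + 1) (n + 1))⁻¹) ^ 2 ≤ αT d L α₀ / 3 :=
    sum_geomProfile_le (d := d) L (n + 1) hL2 hα₀.le
  -- the three positivity witnesses at the produced data
  have hpos' : ∀ x : SiteL2K ℂ d (towerP L m (n + 1)) c₀ W, x ≠ 0 →
      0 < RCLike.re ⟪x, laplacePrimeAk L m n φ η U a' (c₁ := c₁) x⟫_ℂ := fun x hx => by
    have h := HS n η hηL c₀ c₁ hw m U hRS _ hβ0 hβS hUb hUη' εU hεU hεg hUε hUlev x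
    have hx' : 0 < ‖x‖ := norm_pos_iff.2 hx
    have h2 : 0 < γ' * (‖covDerivL2K ℂ c₀ ((η : ℂ))⁻¹ (adTransportW φ (fun _ : Bond d (towerP L m (n + 1)) => (1 : 𝔸ˣ))) x‖ ^ 2 +
        ‖x‖ ^ 2) := mul_pos hγ' (add_pos_of_nonneg_of_pos (sq_nonneg _) (pow_pos hx' 2))
    linarith
  refine ⟨h52, hpos', ?_⟩
  have hposπ : ∀ x : BondL2K ℂ d (towerP L m (n + 1)) c₀ W, x ≠ 0 →
      0 < RCLike.re ⟪x, laplaceAkPi L m n φ τ η U a' hpos' hL (fun j => αT d L α₀ * (((L : ℝ) ^ min (j + 1) (n + 1))⁻¹) ^ 2)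
        (fun j => (geomProfile_le_αT (d := d) L (n + 1) hL hα₀.le j).trans (αT_le hL hα4))
        (ulev_mem_U1_of_pdev L m (n + 1) U hL2 (avgClosed_unitaryUnits d L) hUG hα₀ hα3 hα4 h52)
        (ulev_reg_of_pdev_geometric L m (n + 1) U hL2 (avgClosed_unitaryUnits d L) hUG hα₀ hα3 hα4 h52) (c₁ := c₁) a x⟫_ℂ := fun x hx =>
    HQ n η hηL c₀ c₁ hw hρ' m U _ _ _ _ εU hεU hUε hβ0 hβQ hRS hUb hUη' hpl' hεg hUlev hpos' x hx
  refine ⟨hposπ, ?_⟩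
  have hpos : ∀ x : BondL2K ℂ d (towerP L m (n + 1)) c₀ W, x ≠ 0 →
      0 < RCLike.re ⟪x, laplaceAk L m n φ η U hL (fun j => αT d L α₀ * (((L : ℝ) ^ min (j + 1) (n + 1))⁻¹) ^ 2)
        (fun j => (geomProfile_le_αT (d := d) L (n + 1) hL hα₀.le j).trans (αT_le hL hα4))
        (ulev_mem_U1_of_pdev L m (n + 1) U hL2 (avgClosed_unitaryUnits d L) hUG hα₀ hα3 hα4 h52)
        (ulev_reg_of_pdev_geometric L m (n + 1) U hL2 (avgClosed_unitaryUnits d L) hUG hα₀ hα3 hα4 h52) τ (c₀ := c₀) (c₁ := c₁) a x⟫_ℂ :=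
    fun x hx => HA n η hηL c₀ c₁ hw hρ' m U _ _ _ _ εU hεU hUε hβ0 hβA hRS hUb hUη' hpl' hεg x hx
  -- the surjectivity of `Q_k` at the geometric profile (the `hQ` of the statement)
  have hQ : Function.Surjective (QkW L m n φ U hL (fun j => αT d L α₀ * (((L : ℝ) ^ min (j + 1) (n + 1))⁻¹) ^ 2)
      (fun j => (geomProfile_le_αT (d := d) L (n + 1) hL hα₀.le j).trans (αT_le hL hα4))
      (ulev_mem_U1_of_pdev L m (n + 1) U hL2 (avgClosed_unitaryUnits d L) hUG hα₀ hα3 hα4 h52)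
      (ulev_reg_of_pdev_geometric L m (n + 1) U hL2 (avgClosed_unitaryUnits d L) hUG hα₀ hα3 hα4 h52) (c₀ := c₀) (c₁ := c₁)) :=
    QkW_surjective L m n φ U hL _ _ _ _ hαL'
  -- the Thm 3.12 letter of `H̃_{1,k}` at this lattice, against the ONE majorant `CG`
  obtain ⟨-, hHb⟩ := HL n η hηL c₀ c₁ hw hρ' m hm U _ hα0' _ hαL' _ _ εU hεU hUε hUlev _ hβ0 hβL hUst hUb hUη' hpl' hUgrad' hRlev hεg hAQ hpos' hpos
    hc₀η j₀ hJ hj'' hposπ hQ (L : ℝ) η lev₀ lev₁ levB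
  have hMB : 0 ≤ Mφ * B * Mφ' := by positivity
  have hmax : max ((NegSup.wSup (levWeight (L : ℝ) η lev₀ 1) : ℝ) * (Mφ * B * Mφ')) (NegSup.wSup (levWeight (L : ℝ) η lev₁ 2) * (Mφ * B * Mφ')) ≤
      ω * (Mφ * B * Mφ') :=
    max_le (mul_le_mul_of_nonneg_right hw₀ hMB) (mul_le_mul_of_nonneg_right hw₁ hMB)
  have hHb' : ‖H1LatticeCLM (L := (L : ℝ)) (η := η) (lev₀ := lev₀) (levB := levB) φ hposπ hQ lev₁ (nabla115 η U)‖ ≤ CG := by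
    rw [hCGdef]
    exact hHb.trans (mul_le_mul hmax hwB (NegSup.wInvSup (levWeight (L : ℝ) η levB 0)).coe_nonneg (by positivity))
  have hHpt : ∀ Bf : NegSize (L : ℝ) η levB 0 𝔸,
      ‖H1LatticeCLM (L := (L : ℝ)) (η := η) (lev₀ := lev₀) (levB := levB) φ hposπ hQ lev₁ (nabla115 η U) Bf‖ ≤ CG * ‖Bf‖ :=
    fun Bf => (ContinuousLinearMap.le_opNorm _ Bf).trans (mul_le_mul_of_nonneg_right hHb' (norm_nonneg Bf))
  -- `C_k`'s letter at the radius `ρ` and the Sect. C regime of `(H̃_{1,k}, C_k)` at `(CG, C₂, ρ, a_C, ε_C)` — PRODUCED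
  have hρc3 : 2 * ρ ≤ c3 d L := by linarith
  have hCk := quadAnalytic_Cck L m η (n + 1) U lev₀ lev₁ (nabla115 η U) levB hL2 (avgClosed_unitaryUnits d L) hUG hα₀ hα3 hα4 h52 hlev hρ hρc3
  have RC : Regime (H1LatticeCLM (L := (L : ℝ)) (η := η) (lev₀ := lev₀) (levB := levB) φ hposπ hQ lev₁ (nabla115 η U)) 0
      (Cck L m η (n + 1) U lev₀ lev₁ (nabla115 η U) levB) CG 0 (C2T d α₀) ρ 0 aC εC :=
    Regime.of_normBound_zeroLinear _ hCG hHpt hCk (C2T_nonneg d α₀) hεC.le hCdom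
      (by have h0 : 0 ≤ CG * jT := mul_nonneg hCG hjT.le; linarith) hCcontr
  -- the weight ratio `(Lʲ⁽ᵇ⁾η)³/(Lʲ⁽ᵇ′⁾η)³ ≤ ω³Ω`
  have hratio : ∀ bb b' : Bond d (towerP L m (n + 1)), levWeight (L : ℝ) η lev₀ 3 bb / levWeight (L : ℝ) η lev₀ 3 b' ≤ ϖ := by
    intro bb b'
    have hw3 : ∀ b : Bond d (towerP L m (n + 1)), 0 < levWeight (L : ℝ) η lev₀ 3 b := levWeight_pos (Fact.out : 0 < (L : ℝ)) hη0 lev₀ 3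
    have hnum : levWeight (L : ℝ) η lev₀ 3 bb ≤ ω ^ 3 := by
      have h1 : levWeight (L : ℝ) η lev₀ 1 bb ≤ ω := (NegSup.le_wSup (w := levWeight (L : ℝ) η lev₀ 1) bb).trans hw₀
      have h0 : 0 ≤ levWeight (L : ℝ) η lev₀ 1 bb := (levWeight_pos (Fact.out : 0 < (L : ℝ)) hη0 lev₀ 1 bb).le
      rw [levWeight_apply] at h1 h0 ⊢
      rw [pow_one] at h1 h0
      exact pow_le_pow_left₀ h0 h1 3
    have hden : (levWeight (L : ℝ) η lev₀ 3 b')⁻¹ ≤ Ω := (NegSup.inv_le_wInvSup (w := levWeight (L : ℝ) η lev₀ 3) b').trans hw₃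
    rw [hϖdef, div_eq_mul_inv]
    exact mul_le_mul hnum hden (inv_nonneg.2 (hw3 b').le) (by positivity)
  have hq' : (εC + aC) * (Mφ * B' * Mφ' * (d * latticeConst d δ')) * (C3Gen d L * (2 ^ d * (2 * d))) ≤ 1 / 2 := by
    rw [hΘdef, hΓdef] at hq; exact hq
  -- the contractive trace as an operator of norm `≤ 1`
  have hτn : ‖τc‖ ≤ 1 := ContinuousLinearMap.opNorm_le_bound _ zero_le_one fun X => by simpa only [one_mul] using hτc1 X
  -- the `lev₀`-profile letter `w̲₀⁻¹ ≤ 1 ≤ Ω` from `j(b) ≥ n+1`, `L^{n+1}η = 1`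
  have hΩ₀ : (NegSup.wInvSup (levWeight (L : ℝ) η lev₀ 1) : ℝ) ≤ Ω := by
    have h : NegSup.wInvSup (levWeight (L : ℝ) η lev₀ 1) ≤ 1 :=
      Finset.sup_le fun bb _ => by
        refine inv_le_one_of_one_le₀ ?_
        rw [← NNReal.coe_le_coe, NegSup.coe_wNN (w := levWeight (L : ℝ) η lev₀ 1), levWeight_apply, pow_one, NNReal.coe_one]
        calc (1 : ℝ) = (L : ℝ) ^ (n + 1) * η := by rw [mul_comm]; exact hηL.symm
          _ ≤ (L : ℝ) ^ lev₀ bb * η := mul_le_mul_of_nonneg_right (pow_le_pow_right₀ hL1 (hlev bb)) hη0.le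
    have h' : ((NegSup.wInvSup (levWeight (L : ℝ) η lev₀ 1) : NNReal) : ℝ) ≤ 1 := by exact_mod_cast h
    exact h'.trans hΩ1
  -- the V₀-group's (98)-slot, SUPPLIED (lattice-free `C_V`, `R_V = 1/16`)
  have hqV : ∀ Y : Space115 (L : ℝ) η lev₀ lev₁ (nabla115 η U), ‖Y‖ < 1 / 16 →
      ‖curV0 (lev₁ := lev₁) (Dc := nabla115 η U) ρc τc U Y‖ ≤ CV * ‖Y‖ ^ 2 := by
    intro Y hY
    refine (curV0_quadBound_lattice_uniform (L := (L : ℝ)) (η := η) (lev₀ := lev₀) (lev₁ := lev₁) ρc τc hτc2 hτcs hτc1 hL1 hUb hUst hα0 hpl hω1 hΩ1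
      hw₀ hΩ₀ hw₁' Y hY).trans ?_
    rw [hCVdef]
    have hρ0' : 0 ≤ ‖ρc‖ := norm_nonneg ρc
    have hτ0' : 0 ≤ ‖τc‖ := norm_nonneg τc
    gcongr
  -- the current letter `M_J := ω³` from the window `j₀ ≤ 1` and the profile bound `w̄₀ ≤ ω`
  have hJn : ‖Jcur (L := (L : ℝ)) (η := η) (lev₀ := lev₀) U‖ ≤ ω ^ 3 := by
    have hj0 : (0 : ℝ) ≤ max j₀ 0 := le_max_right _ _
    have hJ' : ∀ μ y, ‖B9Eq39Adjoint.J (fun μ => B9Eq33CovDerivVector.shiftEquiv μ) (fun μ y => U (y, μ)) η μ y‖ ≤ max j₀ 0 :=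
      fun μ y => (hJ μ y).trans (le_max_left _ _)
    have hwb : ∀ bb, levWeight (L : ℝ) η lev₀ 1 bb ≤ ω := fun bb => (NegSup.le_wSup (w := levWeight (L : ℝ) η lev₀ 1) bb).trans hw₀
    have h := norm_Jcur_le_of_window (𝔸 := 𝔸) (L : ℝ) U hj0 (by positivity) (levWeight_three_le (L : ℝ) hwb) hJ'
    refine h.trans ?_
    have h1 : max j₀ 0 ≤ 1 := max_le hj1 zero_le_one
    calc ω ^ 3 * max j₀ 0 ≤ ω ^ 3 * 1 := by gcongr
      _ = ω ^ 3 := mul_one _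
  -- §2 at the produced block (`α := Kα`), the produced regime and the supplied W-letters
  have h := HW n η hηL c₀ c₁ hw hρ' m hm U _ hα0' _ hαL' _ _ εU hεU hUε hUlev _ hβ0 hβW hUst hUb hUη' hpl' hUgrad' hRlev hεg hAQ hpos' hpos
    hc₀η j₀ hJ hjW hposπ hQ lev₀ lev₁ (nabla115 η U) levB hL2 (avgClosed_unitaryUnits d L) hUG hα₀ hα3 hα4 h52 hlev hρ hρ4 hθ hC3 RC haC hεaρ hϖ0 hratio
    hq' hCV (by norm_num : (0 : ℝ) < 1 / 16) hMr zero_le_one (by positivity : (0 : ℝ) ≤ ω ^ 3) hMΔ hRW0 hRWa hRWV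
    ρc τc U hρc' hτn hqV (Jcur (L := (L : ℝ)) (η := η) (lev₀ := lev₀) U) Δπ hJn hΔn
  exact h

end GlobalClass

end Summit.QuantumFields.YangMills.Theorems.Prop7SectET3Prop4

end
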